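import Literature.Geometry.Lorentzian.FinalEraPackage2
import HarnessLib

/-!
# Stub `stub_pairDisperses` (v2-S4) of line `dilated-leaves-virial-certificate` of crux `Capture`
# (stmt-FinalStateConjecture-10115): the pair sector disperses, given pair ledgers

The line `dilated-leaves-virial-certificate` of the crux `Capture` (routes `BartnikGapSettling` /
`QuietWindowCapture`, summit `FinalStateConjecture`; skeleton
`Summits/FinalStateConjecture/FinalStateConjecture/Cruxes/Capture/Lines/dilated_leaves_virial_certificate.lean`,
v2) turns recurrence of all-pairs dilation of a rev-2 final-era package
`p : FinalEraPackage₂ 𝒟` into DISPERSAL.  For the pair sector `p.N ≤ 2` this is bookkeeping into the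
landed two-body escape theorem (`stub_twoBodyEscape`, `BartnikGapSettlingCaptureStubTwoBodyEscape`,
pure real analysis), once the package carries PAIR LEDGERS: for every pair `i ≠ j` a slack constant
`κ' ≥ 0`, a forcing `β' ≥ 0` with `t²β' → 0`, the RELATIVE Einstein–Infeld–Hoffmann law for
`x = ξᵢ − ξⱼ`, `μ = Mᵢ + Mⱼ` with the `κ'`-bracket in relative velocity, and a ledger `E` antitone on
`[T, ∞)`, PN-relatively accurate against `‖x'‖²/2 − μ/‖x‖` (intended witness, the GR content carried
by the era stub S1 of the skeleton: the Bondi energy minus `M₀ + M₁` along cuts adapted to the pair's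
terminal centre-of-momentum frame; Bondi mass loss and "Bondi energy = `1PN` binding energy of a
resolved pair", Blanchet, Living Rev. Relativ. 27 (2024), §3.2.2, eq. (339)).

Why the ledger is a HYPOTHESIS here and not derived from the package: the package's own modulation
clause (W4) has its slack bracket in ABSOLUTE velocities `‖ξᵢ'‖² + ‖ξⱼ'‖²` (a frame term of Kepler-force
size), its forcing `β` is only `L¹`, and it has no energy clause; indeed (W1)–(W4) plus `t₀`-uniform
recurrence admit the `κ`-pumped Kepler ladder (fixed pericentre, energies `E_n ↑ 0⁻`: `lim sup d = ∞`,
`lim inf d` bounded), so no dispersal theorem holds at the package level without a ledger (wave-1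
worker analysis, recorded in the skeleton's v2 docstring).

This file proves the registered stub `stub_pairDisperses` (verbatim signature; its antecedent is the
statement of the landed `stub_twoBodyEscape`, verbatim, fed to it inside the skeleton's `Capture_of` —
stated as a hypothesis so that this file does not import that module).  Proof: for a pair
`i ≠ j`, feed the two-body escape antecedent from time `p.T + 1` on with `μ = Mᵢ + Mⱼ > 0` (sub-extremal labels
have positive mass), `x = ξᵢ − ξⱼ` of class `C²` ((W1) `contDiff_ξ`), `x ≠ 0` (floor (W2)
`le_norm_sub`), `‖x'‖ ≤ 2V` ((W3) `norm_sub_le` via `norm_deriv_le_of_lip'`), the ledger data, and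
recurrence of `‖x‖` read off the all-pairs recurrence.  No named facts, no definitions.

References: Blanchet 2024, §3.2.2, eq. (339); Marchal–Saari, J. Differential Equations 20 (1976), §1;
Dafermos–Luk arXiv:1710.01722, p. 8.
-/

-- the doubled `FinalStateConjecture.FinalStateConjecture` path component trips dupNamespace
set_option linter.dupNamespace false

noncomputable section

namespace Summit.FinalStateConjecture.FinalStateConjecture.Theorems.BartnikGapSettling.Capture

open Set Filter Function Topology
open scoped Manifold ContDiff ENNReal BigOperators
open Literature.Geometry.Lorentzian

/-- **Stub S4 of the line (v2), registered signature verbatim**: a rev-2 final-era package with at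
most two holes, pair ledgers and common-time recurrence of all-pairs dilation DISPERSES
(`‖ξᵢ − ξⱼ‖ → ∞` for `i ≠ j`), given two-body escape (the antecedent, verbatim the statement of the
landed `stub_twoBodyEscape`).  Bookkeeping into the antecedent from time `T + 1` on. [cite: Blanchet2024, §3.2.2, eq. (339)] -/
theorem stub_pairDisperses :
    (∀ (μ V T κ : ℝ) (x : ℝ → E3) (β E : ℝ → ℝ), 0 < μ → 0 ≤ κ → ContDiff ℝ 2 x →
      (∀ t, T ≤ t → x t ≠ 0) → (∀ t, T ≤ t → ‖deriv x t‖ ≤ V) →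
      (∀ t, T ≤ t → 0 ≤ β t) → Tendsto (fun t ↦ t ^ 2 * β t) atTop (𝓝 0) →
      (∀ t, T ≤ t → ‖deriv (deriv x) t + (μ / ‖x t‖ ^ 3) • x t‖ ≤
        κ * (μ / ‖x t‖ ^ 2 * (‖deriv x t‖ ^ 2 + μ / ‖x t‖)) + β t) →
      AntitoneOn E (Ici T) →
      (∀ t, T ≤ t → |E t - (‖deriv x t‖ ^ 2 / 2 - μ / ‖x t‖)| ≤
        κ * (‖deriv x t‖ ^ 2 + μ / ‖x t‖) * (μ / ‖x t‖)) →
      (∀ D' t₀ : ℝ, ∃ t, t₀ ≤ t ∧ D' ≤ ‖x t‖) →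
      Tendsto (fun t ↦ ‖x t‖) atTop atTop) →
    ∀ (X : Type) [TopologicalSpace X] [ChartedSpace E3 X] [IsManifold (𝓡 3) ∞ X] [ConnectedSpace X]
      (D : InitialDataSet (𝓡 3) X) (𝒟 : CauchyDevelopment D) (p : FinalEraPackage₂ 𝒟), p.N ≤ 2 →
      (∀ i j, i ≠ j → ∃ (κ' : ℝ) (β' E : ℝ → ℝ), 0 ≤ κ' ∧ (∀ t, p.T ≤ t → 0 ≤ β' t) ∧
        Tendsto (fun t ↦ t ^ 2 * β' t) atTop (𝓝 0) ∧
        (∀ t, p.T ≤ t →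
          ‖deriv (deriv (p.ξ i - p.ξ j)) t +
              ((p.M i + p.M j) / ‖p.ξ i t - p.ξ j t‖ ^ 3) • (p.ξ i t - p.ξ j t)‖ ≤
            κ' * ((p.M i + p.M j) / ‖p.ξ i t - p.ξ j t‖ ^ 2 *
              (‖deriv (p.ξ i - p.ξ j) t‖ ^ 2 + (p.M i + p.M j) / ‖p.ξ i t - p.ξ j t‖)) + β' t) ∧
        AntitoneOn E (Ici p.T) ∧
        (∀ t, p.T ≤ t →
          |E t - (‖deriv (p.ξ i - p.ξ j) t‖ ^ 2 / 2 - (p.M i + p.M j) / ‖p.ξ i t - p.ξ j t‖)| ≤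
            κ' * (‖deriv (p.ξ i - p.ξ j) t‖ ^ 2 + (p.M i + p.M j) / ‖p.ξ i t - p.ξ j t‖) *
              ((p.M i + p.M j) / ‖p.ξ i t - p.ξ j t‖))) →
      (∀ D' t₀ : ℝ, ∃ t : ℝ, t₀ ≤ t ∧ ∀ i j, i ≠ j → D' ≤ ‖p.ξ i t - p.ξ j t‖) →
        ∀ i j, i ≠ j → Tendsto (fun t ↦ ‖p.ξ i t - p.ξ j t‖) atTop atTop := by
  intro h3 X _ _ _ _ D 𝒟 p _ hL hrec i j hij
  obtain ⟨κ', β', E, hκ', hβ', hβ'0, hlaw, hanti, hacc⟩ := hL i j hij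
  -- positivity of the total mass: sub-extremal labels have positive mass
  have hμ : 0 < p.M i + p.M j := add_pos (p.isSubextremal i).pos (p.isSubextremal j).pos
  -- the relative orbit is `C²`
  have hxC : ContDiff ℝ 2 (p.ξ i - p.ξ j) := (p.contDiff_ξ i).sub (p.contDiff_ξ j)
  -- collision-free after `T` (separation floor)
  have hx0 : ∀ t, p.T + 1 ≤ t → (p.ξ i - p.ξ j) t ≠ 0 := by
    intro t ht h0
    have hfloor := p.le_norm_sub t (by linarith) i j hij
    have h0' : p.ξ i t - p.ξ j t = 0 := h0
    rw [h0', norm_zero] at hfloor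
    exact absurd hfloor (not_le.2 p.δ_pos)
  -- speed of each worldline `≤ V` strictly after `T` (Lipschitz clause (W3))
  have hspeed1 : ∀ l, ∀ t, p.T < t → ‖deriv (p.ξ l) t‖ ≤ p.V := by
    intro l t ht
    refine norm_deriv_le_of_lip' p.V_nonneg ?_
    filter_upwards [Ioi_mem_nhds ht] with s hs
    have hs' : p.T < s := Set.mem_Ioi.1 hs
    rcases le_total t s with hts | hst
    · have h := p.norm_sub_le l t s ht.le hts
      rwa [Real.norm_eq_abs, abs_of_nonneg (sub_nonneg.2 hts)]
    · have h := p.norm_sub_le l s t hs'.le hst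
      rw [norm_sub_rev (p.ξ l s) (p.ξ l t), Real.norm_eq_abs, abs_sub_comm,
        abs_of_nonneg (sub_nonneg.2 hst)]
      exact h
  -- relative speed `≤ 2V` from `T + 1` on
  have hspeed : ∀ t, p.T + 1 ≤ t → ‖deriv (p.ξ i - p.ξ j) t‖ ≤ 2 * p.V := by
    intro t ht
    have ht' : p.T < t := by linarith
    rw [deriv_sub ((p.contDiff_ξ i).differentiable (by norm_num)).differentiableAt
      ((p.contDiff_ξ j).differentiable (by norm_num)).differentiableAt]
    calc ‖deriv (p.ξ i) t - deriv (p.ξ j) t‖ ≤ ‖deriv (p.ξ i) t‖ + ‖deriv (p.ξ j) t‖ :=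
          norm_sub_le _ _
      _ ≤ p.V + p.V := add_le_add (hspeed1 i t ht') (hspeed1 j t ht')
      _ = 2 * p.V := by ring
  -- recurrence of the pair's dilation
  have hrecx : ∀ D' t₀ : ℝ, ∃ t, t₀ ≤ t ∧ D' ≤ ‖(p.ξ i - p.ξ j) t‖ := by
    intro D' t₀
    obtain ⟨t, ht, h⟩ := hrec D' t₀
    exact ⟨t, ht, h i j hij⟩
  -- two-body escape from time `T + 1` on
  exact h3 (p.M i + p.M j) (2 * p.V) (p.T + 1) κ' (p.ξ i - p.ξ j) β' E hμ hκ' hxC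
    hx0 hspeed (fun t ht ↦ hβ' t (by linarith)) hβ'0 (fun t ht ↦ hlaw t (by linarith))
    (hanti.mono (Ici_subset_Ici.2 (by linarith))) (fun t ht ↦ hacc t (by linarith)) hrecx

end Summit.FinalStateConjecture.FinalStateConjecture.Theorems.BartnikGapSettling.Capture

end
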